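import Summits.QuantumFields.YangMills.Theorems.BalabanUVNodesPortS1QtCHop
import Summits.QuantumFields.YangMills.Theorems.BalabanUVNodesPortHRecordJoinSwap
import Literature.MathematicalPhysics.QuantumFieldTheory.Balaban1983to89.B12Lineariz267

/-!
# Port S1, socket (o1) leaf (o1-ε) — `D̃` AT THE RECORD: lit ✓`B12Lineariz267.exists_Dt` ∕ `Dt_unique` ∕ `norm_Dt_le` BY NAME at (`recordCtC`, `hopLinGraphC`, `C₂ = 2∕R²`, `R = 1∕(10⁸dL)`),
# and the linearisation `Q̃_ℂ(B − h_ℂ D̃(B)) = LQ̃_ℂ B` (print p.267), with the norm letter `‖h_ℂ X‖ ≤ b‖X‖` DISPLAYED ((o1-δ) supplies a k-uniform `b`)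

Cell `ym-nodeO-ideate`, porter seat PT-A-1 (gen 9); `--kind proof --supports stmt-QuantumFields-27930 --as helper`; count-neutral.  [I] = [Balaban1987RG1]; [15] = [Balaban1985Variational].

WHAT IS PROVED (standing hypotheses as in (o1-β): `k + 1 ≤ m + K`; background `Vk` (0.4)-guarded with loops within `ε ≤ 1∕50` of `1`; the `b₀`-block letter `RecordB0BlockInvertible` where «LQ̃h = I» is
used; the norm letter `hHop : ∀ X, ‖hopLinGraphC Vk X‖ ≤ b‖X‖` and the two smallness conditions of [15] (98) `9·C₂·b·ρ < 1`, `3ρ ≤ R` DISPLAYED — §3 discharges them at the explicit radius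
`ρ₀(b) = min (R∕3) (1∕(18·C₂·(b+1)))`):
* §1 `trace_recordQtC_apply` ∕ `trace_recordCtC_apply` — on the ball `‖z‖ < R` the complexified constraint and its nonlinear part are trace-free (`det avgMh = 1`, `tr log = 0`).
* §2 ★★★ `exists_recordDt` — THE FUNCTION `D̃` of p.267 at the record: `∃ Dt, ∀ ‖B‖ < ρ, Dt B ∈ closedBall 0 (4C₂ρ²) ∧ C̃_ℂ(B − h_ℂ(Dt B)) = Dt B` (lit `exists_Dt` by name over
  ✓`quadAnalytic_recordCtC`); `recordDt_unique` (lit `Dt_unique`), `norm_recordDt_le` (`‖D̃(B)‖ ≤ 4C₂‖B‖²`, lit `norm_Dt_le`), `norm_hop_recordDt_le`.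
* §3 `recordDt_smallness_of_radius` — the explicit radius `ρ₀(b)` satisfies both smallness conditions; ★ `exists_recordDt₀` — `D̃` on `‖B‖ < ρ₀(b)` with no smallness hypothesis left.
* §4 ★★ `recordQtC_sub_hop_recordDt` — THE LINEARISATION: `Q̃_ℂ(B − h_ℂ D̃(B)) = LQ̃_ℂ B` for `‖B‖ < ρ` (✓`recordLQtC_hopLinGraphC_of_trace_eq_zero`: `D̃(B) = C̃(…)` is trace-free by §1).
LOCATED REMARK.  Lit's `linearizes_Dt` wants `LQ (hop X) = X` on ALL of `𝒳 = (PBond (k+1) → MatA 2)`; at the record it holds on the trace-free fields ((o1-β)₃b §3), which contain every `D̃(B)` — §4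
is the record's form of «LQ̃B′ + C̃(B′) = LQ̃B».

HONEST FRAMING.  `b` is a LETTER here (any bound on DEF-1's `hopLinGraphC`; the k-uniform `b(d, L, α)` from ✓`norm_centralResponse_sub_le` is leaf (o1-δ), NOT here); nothing of (o3) (`Tr log(1 − h δD̃∕δB)`),
`recordFluctInt`, FE-2 is touched; `stub_FE` (XXL) ∕ `stub_P0C` OPEN, ⟨27930⟩ OPEN (1∕3); NODE O 0∕1; COUNT 8∕28 · K 1∕4 UNMOVED; finite `𝕋⁴_{L^K}` at fixed ε — NOT continuum ∕ OS; **the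
Yang–Mills mass gap (Clay) is NOT proved by any of this.**  No `sorry`; standard axioms only.
-/

noncomputable section

open scoped BigOperators Matrix.Norms.L2Operator Topology

open Set Metric Filter

namespace Summit.QuantumFields.YangMills.Theorems.BalabanUVNodesPortS1

open Literature.MathematicalPhysics.QuantumFieldTheory.Balaban1983to89
open Literature.MathematicalPhysics.QuantumFieldTheory.Balaban1983to89.Node00
open Literature.MathematicalPhysics.QuantumFieldTheory.Balaban1983to89.T4Continuum (T4Family)
open Literature.MathematicalPhysics.QuantumFieldTheory.Balaban1983to89.B15AveragingHolomorphic (avgMh loopMh)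
open Summit.QuantumFields.YangMills.Theorems.K0RecordFormatNames
open BlockAveraging (Small Idx)
open ExpMeanLog (expMeanLogSU)
open _root_.Matrix

variable (F : T4Family)

/-! ## §1  `Q̃_ℂ` and `C̃_ℂ` are trace-free on the ball -/

/-- On the ball `‖z‖ < R` the complexified constraint is trace-free at every coarse bond (`det(avgMh · Ū⋆) = 1`, `tr log = 0` inside `‖· − 1‖ ≤ ½`). [cite: Balaban1987RG1, (2.4) p.266, p.267] -/
theorem trace_recordQtC_apply (k K : ℕ) (hk : k + 1 ≤ (F.P K).m + (F.P K).K) (Vk : GaugeField (F.P K) k (SU 2)) {ε : ℝ}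
    (hε : ∀ (c : PBond (F.P K) (k + 1)) (i : Idx (F.P K)), ‖loopM (coeField Vk) c i - 1‖ ≤ ε) (hε50 : ε ≤ 1 / 50)
    (hVk : ∀ c, Small expMeanLogSU Vk c) (z : FluctIdx F k K → ℂ) (hz : ‖z‖ < 1 / (10 ^ 8 * (F.P K).d * (F.P K).L)) (c : PBond (F.P K) (k + 1)) :
    (recordQtC F k K Vk z c).trace = 0 := by
  have hs := norm_pertC_mul_star_sub_one_le F k K Vk z
  have hsum := phi_add_lam_le_of_norm_le (F.P K).hd (F.P K).hL.2.le (norm_nonneg z) hz.le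
  have hW := windows_of_oneStep F k K hk Vk z hs le_rfl le_rfl hε hsum hε50 c (hVk c)
  have hε0 : 0 ≤ ε := (norm_nonneg _).trans (hε c (Classical.arbitrary _))
  have hloop : ∀ i : Idx (F.P K), ‖loopMh (pertC F k K Vk z) c i - 1‖ < 1 / 3 := fun i => (hW.1 i).trans_lt (by linarith)
  rw [recordQtC_apply]
  refine PortHRecordJoin.trace_mlog_eq_zero_of_det_eq_one _ hW.2 ?_
  have hU : (((avOfRecord F 2 K k).avg Vk c : SU 2) : MatA 2).det = 1 := ((avOfRecord F 2 K k).avg Vk c).2.2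
  rw [Matrix.det_mul, det_avgMh_eq_one _ (det_pertC F k K Vk z) c hloop, Matrix.star_eq_conjTranspose, Matrix.det_conjTranspose, hU, star_one, mul_one]

/-- On the ball the nonlinear part `C̃_ℂ = Q̃_ℂ − LQ̃_ℂ` is trace-free. [cite: Balaban1987RG1, p.267] -/
theorem trace_recordCtC_apply (k K : ℕ) (hk : k + 1 ≤ (F.P K).m + (F.P K).K) (Vk : GaugeField (F.P K) k (SU 2)) {ε : ℝ}
    (hε : ∀ (c : PBond (F.P K) (k + 1)) (i : Idx (F.P K)), ‖loopM (coeField Vk) c i - 1‖ ≤ ε) (hε50 : ε ≤ 1 / 50)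
    (hVk : ∀ c, Small expMeanLogSU Vk c) (z : FluctIdx F k K → ℂ) (hz : ‖z‖ < 1 / (10 ^ 8 * (F.P K).d * (F.P K).L)) (c : PBond (F.P K) (k + 1)) :
    (recordCtC F k K Vk z c).trace = 0 := by
  show ((recordQtC F k K Vk z - recordLQtC F k K Vk z) c).trace = 0
  rw [Pi.sub_apply, Matrix.trace_sub, trace_recordQtC_apply F k K hk Vk hε hε50 hVk z hz c, trace_recordLQtC_apply F k K hk Vk hε hε50 hVk z c, sub_zero]

/-! ## §2  `D̃` at the record — lit `exists_Dt` ∕ `Dt_unique` ∕ `norm_Dt_le` by name -/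

/-- ★★★ **THE FUNCTION `D̃` OF p.267 AT THE RECORD** («there exists exactly one solution of this equation … it is an analytic function of B»): for every background in the guard and every bound `b` on
`h_ℂ` with [15] (98)'s smallness `9C₂bρ < 1`, `3ρ ≤ R` (`C₂ = 2∕R²`, `R = 1∕(10⁸dL)`), there is `D̃` on `‖B‖ < ρ`, valued in the closed ball `4C₂ρ²`, solving `C̃_ℂ(B − h_ℂ D̃(B)) = D̃(B)` — lit
✓`B12Lineariz267.exists_Dt` over ✓`quadAnalytic_recordCtC`. [cite: Balaban1987RG1, p.267; Balaban1985Variational, (96)–(98) p.292] -/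
theorem exists_recordDt (k K : ℕ) (hk : k + 1 ≤ (F.P K).m + (F.P K).K) (Vk : GaugeField (F.P K) k (SU 2)) {ε : ℝ}
    (hε : ∀ (c : PBond (F.P K) (k + 1)) (i : Idx (F.P K)), ‖loopM (coeField Vk) c i - 1‖ ≤ ε) (hε50 : ε ≤ 1 / 50)
    (hVk : ∀ c, Small expMeanLogSU Vk c) {b ρ : ℝ} (hb : 0 ≤ b) (hHop : ∀ X, ‖hopLinGraphC F k K Vk X‖ ≤ b * ‖X‖)
    (hq : 9 * (2 * 1 / (1 / (10 ^ 8 * (F.P K).d * (F.P K).L)) ^ 2) * b * ρ < 1) (hρ : 3 * ρ ≤ 1 / (10 ^ 8 * (F.P K).d * (F.P K).L)) :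
    ∃ Dt : (FluctIdx F k K → ℂ) → (PBond (F.P K) (k + 1) → MatA 2), ∀ B : FluctIdx F k K → ℂ, ‖B‖ < ρ →
      Dt B ∈ closedBall (0 : PBond (F.P K) (k + 1) → MatA 2) (4 * (2 * 1 / (1 / (10 ^ 8 * (F.P K).d * (F.P K).L)) ^ 2) * ρ ^ 2) ∧
        recordCtC F k K Vk (B - hopLinGraphC F k K Vk (Dt B)) = Dt B :=
  B12Lineariz267.exists_Dt (quadAnalytic_recordCtC F k K hk Vk hε hε50 hVk) (by positivity) hb hHop hq hρ

/-- **Uniqueness of `D̃`** in the closed ball `4C₂ρ²` (lit ✓`B12Lineariz267.Dt_unique`). [cite: Balaban1987RG1, p.267 («exactly one solution»)] -/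
theorem recordDt_unique (k K : ℕ) (hk : k + 1 ≤ (F.P K).m + (F.P K).K) (Vk : GaugeField (F.P K) k (SU 2)) {ε : ℝ}
    (hε : ∀ (c : PBond (F.P K) (k + 1)) (i : Idx (F.P K)), ‖loopM (coeField Vk) c i - 1‖ ≤ ε) (hε50 : ε ≤ 1 / 50)
    (hVk : ∀ c, Small expMeanLogSU Vk c) {b ρ : ℝ} (hb : 0 ≤ b) (hHop : ∀ X, ‖hopLinGraphC F k K Vk X‖ ≤ b * ‖X‖)
    (hq : 9 * (2 * 1 / (1 / (10 ^ 8 * (F.P K).d * (F.P K).L)) ^ 2) * b * ρ < 1) (hρ : 3 * ρ ≤ 1 / (10 ^ 8 * (F.P K).d * (F.P K).L))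
    {Dt₁ Dt₂ : (FluctIdx F k K → ℂ) → (PBond (F.P K) (k + 1) → MatA 2)}
    (h₁ball : ∀ B, ‖B‖ < ρ → Dt₁ B ∈ closedBall (0 : PBond (F.P K) (k + 1) → MatA 2) (4 * (2 * 1 / (1 / (10 ^ 8 * (F.P K).d * (F.P K).L)) ^ 2) * ρ ^ 2))
    (h₁fix : ∀ B, ‖B‖ < ρ → recordCtC F k K Vk (B - hopLinGraphC F k K Vk (Dt₁ B)) = Dt₁ B)
    (h₂ball : ∀ B, ‖B‖ < ρ → Dt₂ B ∈ closedBall (0 : PBond (F.P K) (k + 1) → MatA 2) (4 * (2 * 1 / (1 / (10 ^ 8 * (F.P K).d * (F.P K).L)) ^ 2) * ρ ^ 2))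
    (h₂fix : ∀ B, ‖B‖ < ρ → recordCtC F k K Vk (B - hopLinGraphC F k K Vk (Dt₂ B)) = Dt₂ B)
    {B : FluctIdx F k K → ℂ} (hB : ‖B‖ < ρ) : Dt₁ B = Dt₂ B :=
  B12Lineariz267.Dt_unique (quadAnalytic_recordCtC F k K hk Vk hε hε50 hVk) (by positivity) hb hHop hq hρ h₁ball h₁fix h₂ball h₂fix hB

/-- **«D̃(B) has an expansion beginning with quadratic terms»**: `‖D̃(B)‖ ≤ 4C₂‖B‖²` (lit ✓`B12Lineariz267.norm_Dt_le`). [cite: Balaban1987RG1, p.267; Balaban1985Variational, (55) p.286] -/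
theorem norm_recordDt_le (k K : ℕ) (hk : k + 1 ≤ (F.P K).m + (F.P K).K) (Vk : GaugeField (F.P K) k (SU 2)) {ε : ℝ}
    (hε : ∀ (c : PBond (F.P K) (k + 1)) (i : Idx (F.P K)), ‖loopM (coeField Vk) c i - 1‖ ≤ ε) (hε50 : ε ≤ 1 / 50)
    (hVk : ∀ c, Small expMeanLogSU Vk c) {b ρ : ℝ} (hb : 0 ≤ b) (hHop : ∀ X, ‖hopLinGraphC F k K Vk X‖ ≤ b * ‖X‖)
    (hq : 9 * (2 * 1 / (1 / (10 ^ 8 * (F.P K).d * (F.P K).L)) ^ 2) * b * ρ < 1) (hρ : 3 * ρ ≤ 1 / (10 ^ 8 * (F.P K).d * (F.P K).L))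
    {Dt : (FluctIdx F k K → ℂ) → (PBond (F.P K) (k + 1) → MatA 2)}
    (hball : ∀ B, ‖B‖ < ρ → Dt B ∈ closedBall (0 : PBond (F.P K) (k + 1) → MatA 2) (4 * (2 * 1 / (1 / (10 ^ 8 * (F.P K).d * (F.P K).L)) ^ 2) * ρ ^ 2))
    (hfix : ∀ B, ‖B‖ < ρ → recordCtC F k K Vk (B - hopLinGraphC F k K Vk (Dt B)) = Dt B) {B : FluctIdx F k K → ℂ} (hB : ‖B‖ < ρ) :
    ‖Dt B‖ ≤ 4 * (2 * 1 / (1 / (10 ^ 8 * (F.P K).d * (F.P K).L)) ^ 2) * ‖B‖ ^ 2 :=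
  B12Lineariz267.norm_Dt_le (quadAnalytic_recordCtC F k K hk Vk hε hε50 hVk) (by positivity) hb hHop hq hρ hball hfix hB

/-- The size of the correction `h_ℂ D̃(B)`: `≤ 4C₂b‖B‖²` and `≤ ρ` (lit ✓`B12Lineariz267.norm_hop_Dt_le`). [cite: Balaban1987RG1, p.267; Balaban1985Variational, (98) p.292] -/
theorem norm_hop_recordDt_le (k K : ℕ) (hk : k + 1 ≤ (F.P K).m + (F.P K).K) (Vk : GaugeField (F.P K) k (SU 2)) {ε : ℝ}
    (hε : ∀ (c : PBond (F.P K) (k + 1)) (i : Idx (F.P K)), ‖loopM (coeField Vk) c i - 1‖ ≤ ε) (hε50 : ε ≤ 1 / 50)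
    (hVk : ∀ c, Small expMeanLogSU Vk c) {b ρ : ℝ} (hb : 0 ≤ b) (hHop : ∀ X, ‖hopLinGraphC F k K Vk X‖ ≤ b * ‖X‖)
    (hq : 9 * (2 * 1 / (1 / (10 ^ 8 * (F.P K).d * (F.P K).L)) ^ 2) * b * ρ < 1) (hρ : 3 * ρ ≤ 1 / (10 ^ 8 * (F.P K).d * (F.P K).L))
    {Dt : (FluctIdx F k K → ℂ) → (PBond (F.P K) (k + 1) → MatA 2)}
    (hball : ∀ B, ‖B‖ < ρ → Dt B ∈ closedBall (0 : PBond (F.P K) (k + 1) → MatA 2) (4 * (2 * 1 / (1 / (10 ^ 8 * (F.P K).d * (F.P K).L)) ^ 2) * ρ ^ 2))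
    (hfix : ∀ B, ‖B‖ < ρ → recordCtC F k K Vk (B - hopLinGraphC F k K Vk (Dt B)) = Dt B) {B : FluctIdx F k K → ℂ} (hB : ‖B‖ < ρ) :
    ‖hopLinGraphC F k K Vk (Dt B)‖ ≤ 4 * (2 * 1 / (1 / (10 ^ 8 * (F.P K).d * (F.P K).L)) ^ 2) * b * ‖B‖ ^ 2 ∧ ‖hopLinGraphC F k K Vk (Dt B)‖ ≤ ρ :=
  B12Lineariz267.norm_hop_Dt_le (quadAnalytic_recordCtC F k K hk Vk hε hε50 hVk) (by positivity) hb hHop hq hρ hball hfix hB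

/-! ## §3  The explicit radius `ρ₀(b) = min (R∕3) (1∕(18·C₂·(b+1)))` -/

/-- At `ρ₀(b) := min (R∕3) (1∕(18·C₂·(b+1)))` both smallness conditions hold and `ρ₀ > 0`. [cite: Balaban1985Variational, (98) p.292] -/
theorem recordDt_smallness_of_radius {R C₂ b : ℝ} (hR : 0 < R) (hC₂ : 0 < C₂) (hb : 0 ≤ b) :
    0 < min (R / 3) (1 / (18 * C₂ * (b + 1))) ∧ 9 * C₂ * b * min (R / 3) (1 / (18 * C₂ * (b + 1))) < 1 ∧ 3 * min (R / 3) (1 / (18 * C₂ * (b + 1))) ≤ R := by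
  have h18 : 0 < 18 * C₂ * (b + 1) := by positivity
  refine ⟨lt_min (by linarith) (by positivity), ?_, ?_⟩
  · calc 9 * C₂ * b * min (R / 3) (1 / (18 * C₂ * (b + 1))) ≤ 9 * C₂ * b * (1 / (18 * C₂ * (b + 1))) :=
          mul_le_mul_of_nonneg_left (min_le_right _ _) (by positivity)
      _ = (9 * C₂ * b) / (18 * C₂ * (b + 1)) := by ring
      _ < 1 := by rw [div_lt_one h18]; nlinarith
  · linarith [min_le_left (R / 3) (1 / (18 * C₂ * (b + 1)))]

/-- ★ **`D̃` ON THE EXPLICIT BALL `‖B‖ < ρ₀(b)`** — no smallness hypothesis left; `ρ₀` depends on `d, L` and the bound `b` on `h_ℂ` only. [cite: Balaban1987RG1, p.267; Balaban1985Variational, (98) p.292] -/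
theorem exists_recordDt₀ (k K : ℕ) (hk : k + 1 ≤ (F.P K).m + (F.P K).K) (Vk : GaugeField (F.P K) k (SU 2)) {ε : ℝ}
    (hε : ∀ (c : PBond (F.P K) (k + 1)) (i : Idx (F.P K)), ‖loopM (coeField Vk) c i - 1‖ ≤ ε) (hε50 : ε ≤ 1 / 50)
    (hVk : ∀ c, Small expMeanLogSU Vk c) {b : ℝ} (hb : 0 ≤ b) (hHop : ∀ X, ‖hopLinGraphC F k K Vk X‖ ≤ b * ‖X‖) :
    0 < min ((1 : ℝ) / (10 ^ 8 * (F.P K).d * (F.P K).L) / 3) (1 / (18 * (2 * 1 / (1 / (10 ^ 8 * (F.P K).d * (F.P K).L)) ^ 2) * (b + 1))) ∧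
    ∃ Dt : (FluctIdx F k K → ℂ) → (PBond (F.P K) (k + 1) → MatA 2), ∀ B : FluctIdx F k K → ℂ,
      ‖B‖ < min ((1 : ℝ) / (10 ^ 8 * (F.P K).d * (F.P K).L) / 3) (1 / (18 * (2 * 1 / (1 / (10 ^ 8 * (F.P K).d * (F.P K).L)) ^ 2) * (b + 1))) →
      Dt B ∈ closedBall (0 : PBond (F.P K) (k + 1) → MatA 2) (4 * (2 * 1 / (1 / (10 ^ 8 * (F.P K).d * (F.P K).L)) ^ 2) *
          min ((1 : ℝ) / (10 ^ 8 * (F.P K).d * (F.P K).L) / 3) (1 / (18 * (2 * 1 / (1 / (10 ^ 8 * (F.P K).d * (F.P K).L)) ^ 2) * (b + 1))) ^ 2) ∧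
        recordCtC F k K Vk (B - hopLinGraphC F k K Vk (Dt B)) = Dt B := by
  have hd : (1 : ℝ) ≤ (F.P K).d := by exact_mod_cast (F.P K).hd
  have hL : (1 : ℝ) ≤ (F.P K).L := by exact_mod_cast (F.P K).hL.2.le
  have hR : (0 : ℝ) < 1 / (10 ^ 8 * (F.P K).d * (F.P K).L) := by positivity
  have hC₂ : (0 : ℝ) < 2 * 1 / (1 / (10 ^ 8 * (F.P K).d * (F.P K).L)) ^ 2 := by positivity
  obtain ⟨h0, hq, h3⟩ := recordDt_smallness_of_radius hR hC₂ hb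
  exact ⟨h0, exists_recordDt F k K hk Vk hε hε50 hVk hb hHop hq h3⟩

/-! ## §4  The linearisation `Q̃_ℂ(B − h_ℂ D̃(B)) = LQ̃_ℂ B` -/

/-- ★★ **THE LINEARISATION OF p.267**: for `‖B‖ < ρ`, `Q̃_ℂ(B − h_ℂ D̃(B)) = LQ̃_ℂ B` — «LQ̃B′ + C̃(B′) = LQ̃B − D + C̃(B − hD) = LQ̃B» with «LQ̃h = I» used on the TRACE-FREE field `D = D̃(B)`
(✓`recordLQtC_hopLinGraphC_of_trace_eq_zero`; `D̃(B) = C̃_ℂ(B − h_ℂD̃(B))` is trace-free by §1 since `‖B − h_ℂD̃(B)‖ < 2ρ ≤ R`). [cite: Balaban1987RG1, p.267 (displayed equation)] -/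
theorem recordQtC_sub_hop_recordDt (k K : ℕ) (hk : k + 1 ≤ (F.P K).m + (F.P K).K) (Vk : GaugeField (F.P K) k (SU 2)) {ε : ℝ}
    (hε : ∀ (c : PBond (F.P K) (k + 1)) (i : Idx (F.P K)), ‖loopM (coeField Vk) c i - 1‖ ≤ ε) (hε50 : ε ≤ 1 / 50)
    (hVk : ∀ c, Small expMeanLogSU Vk c) (hA : RecordB0BlockInvertible F k K Vk) {b ρ : ℝ} (hb : 0 ≤ b) (hHop : ∀ X, ‖hopLinGraphC F k K Vk X‖ ≤ b * ‖X‖)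
    (hq : 9 * (2 * 1 / (1 / (10 ^ 8 * (F.P K).d * (F.P K).L)) ^ 2) * b * ρ < 1) (hρ : 3 * ρ ≤ 1 / (10 ^ 8 * (F.P K).d * (F.P K).L))
    {Dt : (FluctIdx F k K → ℂ) → (PBond (F.P K) (k + 1) → MatA 2)}
    (hball : ∀ B, ‖B‖ < ρ → Dt B ∈ closedBall (0 : PBond (F.P K) (k + 1) → MatA 2) (4 * (2 * 1 / (1 / (10 ^ 8 * (F.P K).d * (F.P K).L)) ^ 2) * ρ ^ 2))
    (hfix : ∀ B, ‖B‖ < ρ → recordCtC F k K Vk (B - hopLinGraphC F k K Vk (Dt B)) = Dt B) {B : FluctIdx F k K → ℂ} (hB : ‖B‖ < ρ) :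
    recordQtC F k K Vk (B - hopLinGraphC F k K Vk (Dt B)) = recordLQtC F k K Vk B := by
  have hfixB := hfix B hB
  have hhop := (norm_hop_recordDt_le F k K hk Vk hε hε50 hVk hb hHop hq hρ hball hfix hB).2
  have hρ0 : 0 ≤ ρ := (norm_nonneg _).trans hB.le
  have hB' : ‖B - hopLinGraphC F k K Vk (Dt B)‖ < 1 / (10 ^ 8 * (F.P K).d * (F.P K).L) := by
    calc ‖B - hopLinGraphC F k K Vk (Dt B)‖ ≤ ‖B‖ + ‖hopLinGraphC F k K Vk (Dt B)‖ := norm_sub_le _ _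
      _ < ρ + ρ := by linarith
      _ ≤ 1 / (10 ^ 8 * (F.P K).d * (F.P K).L) := by linarith
  have htr : ∀ c, (Dt B c).trace = 0 := fun c => by
    rw [← hfixB]; exact trace_recordCtC_apply F k K hk Vk hε hε50 hVk _ hB' c
  rw [← recordLQtC_add_recordCtC, hfixB, map_sub, recordLQtC_hopLinGraphC_of_trace_eq_zero F k K hk Vk hε hε50 hVk hA _ htr, sub_add_cancel]

end Summit.QuantumFields.YangMills.Theorems.BalabanUVNodesPortS1

end
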